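import Summits.NavierStokesRegularity.NavierStokesRegularity.Theses.LevelSetModeration
import Literature.Analysis.FluidPDE.TaoLocalisationHolds
import Literature.Analysis.FluidPDE.TaoLocalisationProofs

/-!
# Route LevelSetModeration — slices of classical Leray–Hopf solutions vanish at infinity

Support file for item stmt-NavierStokesRegularity-18149 (`HighSpeedPressureWork`) and its lines
(every level-set / moderation argument integrates by parts against the truncated field
`(1 - c/|u|)₊ u`, whose support is the closure of the super-level set `{|u| > c}`; the landed
`ModerationIdentity` and the registered stubs `stub_levelSetIBP`, `stub_moderatedSplit`,
`stub_sliceRegularity` all ask for `Bornology.IsBounded {x | c < ‖u τ x‖}`).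

* `levelSetModeration_tendsto_cocompact_of_fderiv_le` — a `C¹` map on `ℝ³` with bounded derivative
  and finite `∫ ‖g‖²` tends to `0` at infinity (a point where `‖g‖ ≥ ε` carries `L²`-mass
  `≥ (ε/2)² |B_δ|` on the ball of radius `δ = ε/(2L+2)`, and the tail mass tends to `0`);
* `levelSetModeration_slice_fderiv_bound` — on every closed slab `[0, T₁]`, `T₁ < T`, the velocity
  gradient of a classical Leray–Hopf solution from a rapidly decaying datum is bounded
  (Tao 2013, Cor. 11.1: `u ∈ L^∞_t H^k_x` on closed slabs, `tao2011_hasBoundedSobolevNormsOn_holds`;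
  Sobolev imbedding `H² ⊂ C_B` applied to `Du`, `exists_enorm_le_sobolev_two_two_dim_three`);
* `levelSetModeration_slice_tendsto_cocompact`, `levelSetModeration_isBounded_superlevel` — every
  slice `u τ`, `τ ∈ [0, T)`, tends to `0` at spatial infinity, so `{x | c < ‖u τ x‖}` is bounded for
  every `c > 0`.

## References
* T. Tao, *Localisation and compactness properties of the Navier–Stokes global regularity problem*,
  Anal. PDE 6 (2013), Cor. 11.1, Cor. 4.3, Thm. 5.4 (iv). [Tao2011]
* R. A. Adams, *Sobolev Spaces* (1975), Thm. 5.4. [Adams1975]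
-/

noncomputable section

-- single-conjunct summit: `Summit.<Summit>.<Problem>` repeats the name by the D-0017 layout
set_option linter.dupNamespace false

namespace Summit.NavierStokesRegularity.NavierStokesRegularity.Theorems

open MeasureTheory Set Filter Topology Metric
open scoped ENNReal
open Literature.Analysis.FluidPDE

/-! ### `C¹` with bounded derivative and finite `L²` mass ⇒ vanishing at infinity -/

/-- **A Lipschitz `L²` map vanishes at infinity.** Let `g : ℝ³ → F` be differentiable with
`‖Dg‖ ≤ L` everywhere and `∫ ‖g‖² < ∞`. Then `g(x) → 0` as `|x| → ∞`. Proof: if `‖g(x₀)‖ ≥ ε`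
then `‖g‖ ≥ ε/2` on the ball `B(x₀, δ)`, `δ = ε/(2L+2)`, which therefore carries mass
`(ε/2)² |B_δ| > 0`; the mass of `g` outside the ball `B̄(0, n)` tends to `0` (dominated
convergence), so no such `x₀` lies outside a large ball. [folklore] -/
theorem levelSetModeration_tendsto_cocompact_of_fderiv_le {G : Type*} [NormedAddCommGroup G]
    [NormedSpace ℝ G] {g : EuclideanSpace ℝ (Fin 3) → G} (hg : Differentiable ℝ g) {L : ℝ}
    (hL : ∀ x, ‖fderiv ℝ g x‖ ≤ L) (hint : ∫⁻ x, ‖g x‖ₑ ^ 2 < ∞) :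
    Tendsto g (cocompact (EuclideanSpace ℝ (Fin 3))) (𝓝 0) := by
  have hgc : Continuous g := hg.continuous
  have hL0 : 0 ≤ L := (norm_nonneg _).trans (hL 0)
  -- Lipschitz bound from the mean value inequality
  have hlip : ∀ x y, ‖g y - g x‖ ≤ L * ‖y - x‖ := fun x y =>
    (convex_univ (𝕜 := ℝ) (E := EuclideanSpace ℝ (Fin 3))).norm_image_sub_le_of_norm_fderiv_le
      (fun z _ => hg z) (fun z _ => hL z) (mem_univ x) (mem_univ y)
  rw [Metric.tendsto_nhds]
  intro ε hε
  -- the radius `δ` and the mass threshold `m₀`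
  set L' : ℝ := L + 1 with hL'
  have hL'0 : 0 < L' := by linarith
  set δ : ℝ := ε / (2 * L') with hδ
  have hδ0 : 0 < δ := by positivity
  have hLδ : L * δ ≤ ε / 2 := by
    have h1 : L * δ ≤ L' * δ := mul_le_mul_of_nonneg_right (by linarith) hδ0.le
    have h2 : L' * δ = ε / 2 := by
      rw [hδ]; field_simp
    linarith
  set m₀ : ℝ≥0∞ := ENNReal.ofReal ((ε / 2) ^ 2) * volume (ball (0 : EuclideanSpace ℝ (Fin 3)) δ)
    with hm₀
  have hm₀pos : 0 < m₀ := by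
    refine ENNReal.mul_pos ?_ (measure_ball_pos volume _ hδ0).ne'
    exact (ENNReal.ofReal_pos.2 (by positivity)).ne'
  -- mass lower bound on a ball around a point where `‖g‖ ≥ ε`
  have hmass : ∀ x₀, ε ≤ ‖g x₀‖ → m₀ ≤ ∫⁻ x in ball x₀ δ, ‖g x‖ₑ ^ 2 := by
    intro x₀ hx₀
    have hpt : ∀ x ∈ ball x₀ δ, ENNReal.ofReal ((ε / 2) ^ 2) ≤ ‖g x‖ₑ ^ 2 := by
      intro x hx
      have hdist : ‖x - x₀‖ < δ := by rwa [mem_ball, dist_eq_norm] at hx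
      have h1 : ‖g x₀‖ - ‖g x - g x₀‖ ≤ ‖g x‖ := by
        have := norm_sub_norm_le (g x₀) (g x)
        rw [← norm_neg (g x - g x₀), neg_sub]
        linarith [norm_sub_norm_le (g x₀) (g x), abs_norm_sub_norm_le (g x₀) (g x)]
      have h2 : ‖g x - g x₀‖ ≤ ε / 2 := by
        calc ‖g x - g x₀‖ ≤ L * ‖x - x₀‖ := hlip x₀ x
          _ ≤ L * δ := mul_le_mul_of_nonneg_left hdist.le hL0
          _ ≤ ε / 2 := hLδ
      have h3 : ε / 2 ≤ ‖g x‖ := by linarith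
      calc ENNReal.ofReal ((ε / 2) ^ 2) ≤ ENNReal.ofReal (‖g x‖ ^ 2) :=
            ENNReal.ofReal_le_ofReal (pow_le_pow_left₀ (by positivity) h3 2)
        _ = ‖g x‖ₑ ^ 2 := by
            rw [← ofReal_norm, ENNReal.ofReal_pow (norm_nonneg _)]
    calc m₀ = ENNReal.ofReal ((ε / 2) ^ 2) * volume (ball x₀ δ) := by
          rw [hm₀, Measure.addHaar_ball_center volume x₀ δ]
      _ = ∫⁻ _ in ball x₀ δ, ENNReal.ofReal ((ε / 2) ^ 2) := by rw [setLIntegral_const]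
      _ ≤ ∫⁻ x in ball x₀ δ, ‖g x‖ₑ ^ 2 := setLIntegral_mono' measurableSet_ball hpt
  -- the tail mass tends to zero
  have hmeas : Measurable fun x => ‖g x‖ₑ ^ 2 :=
    ((continuous_enorm.comp hgc).measurable).pow_const 2
  have htail : Tendsto (fun n : ℕ => ∫⁻ x in (closedBall (0 : EuclideanSpace ℝ (Fin 3)) n)ᶜ,
      ‖g x‖ₑ ^ 2) atTop (𝓝 0) := by
    have h := tendsto_lintegral_of_dominated_convergence (μ := volume)
      (F := fun (n : ℕ) x => ((closedBall (0 : EuclideanSpace ℝ (Fin 3)) n)ᶜ).indicator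
        (fun x => ‖g x‖ₑ ^ 2) x) (f := fun _ => 0) (fun x => ‖g x‖ₑ ^ 2)
      (fun n => hmeas.indicator measurableSet_closedBall.compl)
      (fun n => Eventually.of_forall fun x => indicator_le_self _ _ x) hint.ne
      (Eventually.of_forall fun x => ?_)
    · simpa [lintegral_indicator measurableSet_closedBall.compl] using h
    · -- eventually `x ∈ closedBall 0 n`, where the indicator vanishes
      refine tendsto_const_nhds.congr' ?_
      obtain ⟨N, hN⟩ := exists_nat_ge ‖x‖
      filter_upwards [eventually_ge_atTop N] with n hn
      have hx : x ∉ (closedBall (0 : EuclideanSpace ℝ (Fin 3)) n)ᶜ := by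
        rw [notMem_compl_iff, mem_closedBall, dist_zero_right]
        exact hN.trans (Nat.cast_le.2 hn)
      rw [indicator_of_notMem hx]
  obtain ⟨N, hN⟩ := (eventually_atTop.1 ((tendsto_order.1 htail).2 m₀ hm₀pos))
  -- conclusion: `‖g x‖ < ε` outside the closed ball of radius `N + δ`
  have hK : IsCompact (closedBall (0 : EuclideanSpace ℝ (Fin 3)) (N + δ)) :=
    isCompact_closedBall _ _
  filter_upwards [hK.compl_mem_cocompact] with x hx
  rw [dist_zero_right]
  by_contra hge
  rw [not_lt] at hge
  have hxN : ball x δ ⊆ (closedBall (0 : EuclideanSpace ℝ (Fin 3)) N)ᶜ := by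
    intro y hy
    rw [mem_compl_iff, mem_closedBall, dist_zero_right, not_le]
    rw [mem_compl_iff, mem_closedBall, dist_zero_right, not_le] at hx
    rw [mem_ball, dist_eq_norm] at hy
    have : ‖x‖ ≤ ‖y‖ + ‖y - x‖ := by
      calc ‖x‖ = ‖y - (y - x)‖ := by rw [sub_sub_cancel]
        _ ≤ ‖y‖ + ‖y - x‖ := norm_sub_le _ _
    linarith
  have h1 : m₀ ≤ ∫⁻ y in (closedBall (0 : EuclideanSpace ℝ (Fin 3)) N)ᶜ, ‖g y‖ₑ ^ 2 :=
    (hmass x hge).trans (lintegral_mono_set hxN)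
  exact absurd (hN N le_rfl) (not_lt.2 h1)

/-- A continuous map tending to `0` at infinity has bounded super-level sets `{x | c < ‖g x‖}`,
`c > 0`. [folklore] -/
theorem levelSetModeration_isBounded_superlevel_of_tendsto {G : Type*} [NormedAddCommGroup G]
    {g : EuclideanSpace ℝ (Fin 3) → G}
    (hg : Tendsto g (cocompact (EuclideanSpace ℝ (Fin 3))) (𝓝 0)) {c : ℝ} (hc : 0 < c) :
    Bornology.IsBounded {x | c < ‖g x‖} := by
  have hev : ∀ᶠ x in cocompact (EuclideanSpace ℝ (Fin 3)), ‖g x‖ < c := by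
    have := (Metric.tendsto_nhds.1 hg) c hc
    simpa [dist_zero_right] using this
  obtain ⟨K, hK, hKc⟩ := mem_cocompact.1 hev
  refine hK.isBounded.subset fun x hx => ?_
  by_contra hxK
  have : ‖g x‖ < c := hKc hxK
  exact absurd hx (not_lt.2 this.le)

/-! ### Slices of classical Leray–Hopf solutions -/

/-- **All spatial Sobolev norms are bounded on closed slabs** for a classical solution of the
unforced Navier–Stokes system on `ℝ³ × [0, T)` which is Leray–Hopf from its rapidly decaying datum:
for `T₁ ∈ (0, T)`, `HasBoundedSobolevNormsOn (Icc 0 T₁) u` (Tao 2013, Cor. 11.1 + Cor. 4.3 +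
Thm. 5.4 (iv), the discharged named fact `tao2011_hasBoundedSobolevNormsOn_holds`; the energy
bound on the closed slab is the Leray–Hopf energy inequality). [cite: Tao2011, Cor. 11.1] -/
theorem levelSetModeration_hasBoundedSobolevNormsOn_slab {ν T : ℝ} (hν : 0 < ν)
    {u : ℝ → EuclideanSpace ℝ (Fin 3) → EuclideanSpace ℝ (Fin 3)}
    {p : ℝ → EuclideanSpace ℝ (Fin 3) → ℝ}
    (hcl : IsClassicalNSSolutionOn (Ico 0 T) ν 0 u p) (hLH : IsLerayHopfOn T ν 0 (u 0) u)
    (hdec : HasRapidSpatialDecay (u 0)) {T₁ : ℝ} (hT₁ : T₁ ∈ Ioo 0 T) :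
    HasBoundedSobolevNormsOn (Icc 0 T₁) u := by
  have hsol' : IsClassicalNSSolutionOn (Icc 0 T₁) ν 0 u p :=
    hcl.mono (Icc_subset_Ico_right hT₁.2) (uniqueDiffOn_Icc hT₁.1)
  have hEn' : ∃ C : ℝ≥0∞, C < ⊤ ∧ ∀ t ∈ Icc 0 T₁, ∫⁻ x, ‖u t x‖ₑ ^ 2 ≤ C :=
    ⟨ENNReal.ofReal (2 * VectorCalculus.kineticEnergy (u 0)), ENNReal.ofReal_lt_top, fun t ht =>
      hLH.lintegral_enorm_sq_le hν.le ⟨ht.1, ht.2.trans hT₁.2.le⟩⟩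
  exact (tao2011_hasBoundedSobolevNormsOn.closedSlab tao2011_hasBoundedSobolevNormsOn_holds
    linfty_bound_of_hasBoundedSobolevNormsOn_holds ν T₁ hν hT₁.1 u p hsol' hEn' hdec).1

/-- **The velocity gradient is bounded on closed slabs.** Under the same hypotheses, for every
`T₁ ∈ (0, T)` there is `L` with `‖Du(τ, x)‖ ≤ L` on `[0, T₁] × ℝ³` (the Sobolev imbedding
`H² ⊂ C_B` of `exists_enorm_le_sobolev_two_two_dim_three` applied to the `C²` map `Du(τ)`, whose
Sobolev norms of orders `≤ 2` are those of `u(τ)` of orders `1 … 3`,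
`norm_iteratedFDeriv_fderiv`). [cite: Adams1975, Thm. 5.4] -/
theorem levelSetModeration_slice_fderiv_bound {ν T : ℝ} (hν : 0 < ν)
    {u : ℝ → EuclideanSpace ℝ (Fin 3) → EuclideanSpace ℝ (Fin 3)}
    {p : ℝ → EuclideanSpace ℝ (Fin 3) → ℝ}
    (hcl : IsClassicalNSSolutionOn (Ico 0 T) ν 0 u p) (hLH : IsLerayHopfOn T ν 0 (u 0) u)
    (hdec : HasRapidSpatialDecay (u 0)) {T₁ : ℝ} (hT₁ : T₁ ∈ Ioo 0 T) :
    ∃ L : ℝ, ∀ τ ∈ Icc 0 T₁, ∀ x, ‖fderiv ℝ (u τ) x‖ ≤ L := by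
  have hH := levelSetModeration_hasBoundedSobolevNormsOn_slab hν hcl hLH hdec hT₁
  choose C hC using hH
  obtain ⟨K, hK, hbound⟩ := Literature.Analysis.FunctionSpaces.exists_enorm_le_sobolev_two_two_dim_three
    (E := EuclideanSpace ℝ (Fin 3)) (F := EuclideanSpace ℝ (Fin 3) →L[ℝ] EuclideanSpace ℝ (Fin 3))
    (volume : Measure (EuclideanSpace ℝ (Fin 3))) finrank_euclideanSpace_fin
  set R : ℝ≥0∞ := K * ∑ j ∈ Finset.range 3, ((C (j + 1) : ℝ≥0∞) ^ (1 / 2 : ℝ)) with hR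
  have hRtop : R < ⊤ := by
    refine ENNReal.mul_lt_top hK (ENNReal.sum_lt_top.2 fun j _ => ?_)
    exact ENNReal.rpow_lt_top_of_nonneg (by norm_num) ENNReal.coe_ne_top
  refine ⟨R.toReal, fun τ hτ x => ?_⟩
  have hτ' : τ ∈ Ico 0 T := ⟨hτ.1, hτ.2.trans_lt hT₁.2⟩
  have h3 : ContDiff ℝ 3 (u τ) := (hcl.contDiff_velocity hτ').of_le (by norm_cast)
  have hC2 : ContDiff ℝ 2 (fderiv ℝ (u τ)) := h3.fderiv_right (m := 2) (by norm_cast)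
  have h1 : ‖fderiv ℝ (u τ) x‖ₑ ≤ R := by
    refine (hbound (fderiv ℝ (u τ)) hC2 x).trans ?_
    rw [hR]
    gcongr with j hj
    -- `‖D^j (Du)‖_{L²} = ‖D^{j+1} u‖_{L²} ≤ C_{j+1}^{1/2}`
    have heq : eLpNorm (iteratedFDeriv ℝ j (fderiv ℝ (u τ))) 2 volume =
        eLpNorm (iteratedFDeriv ℝ (j + 1) (u τ)) 2 volume := by
      rw [← eLpNorm_norm (iteratedFDeriv ℝ j (fderiv ℝ (u τ))),
        ← eLpNorm_norm (iteratedFDeriv ℝ (j + 1) (u τ))]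
      simp_rw [norm_iteratedFDeriv_fderiv]
    rw [heq]
    exact eLpNorm_two_le_rpow_of_lintegral_sq_le (hC (j + 1) τ hτ)
  calc ‖fderiv ℝ (u τ) x‖ = (‖fderiv ℝ (u τ) x‖ₑ).toReal := (toReal_enorm _).symm
    _ ≤ R.toReal := ENNReal.toReal_mono hRtop.ne h1

/-- **Slices of a classical Leray–Hopf solution vanish at spatial infinity.** For `ν > 0`, a
classical solution of the unforced Navier–Stokes system on `ℝ³ × [0, T)` which is Leray–Hopf on
`[0, T]` from its rapidly decaying datum, and every `τ ∈ [0, T)`: `u(τ, x) → 0` as `|x| → ∞`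
(bounded gradient on the closed slab `[0, (τ+T)/2]` and finite energy of the slice). [cite: Tao2011, Cor. 11.1] -/
theorem levelSetModeration_slice_tendsto_cocompact {ν T : ℝ} (hν : 0 < ν)
    {u : ℝ → EuclideanSpace ℝ (Fin 3) → EuclideanSpace ℝ (Fin 3)}
    {p : ℝ → EuclideanSpace ℝ (Fin 3) → ℝ}
    (hcl : IsClassicalNSSolutionOn (Ico 0 T) ν 0 u p) (hLH : IsLerayHopfOn T ν 0 (u 0) u)
    (hdec : HasRapidSpatialDecay (u 0)) {τ : ℝ} (hτ : τ ∈ Ico 0 T) :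
    Tendsto (u τ) (cocompact (EuclideanSpace ℝ (Fin 3))) (𝓝 0) := by
  have hT₁ : (τ + T) / 2 ∈ Ioo 0 T := ⟨by linarith [hτ.1, hτ.2], by linarith [hτ.2]⟩
  have hτ₁ : τ ∈ Icc 0 ((τ + T) / 2) := ⟨hτ.1, by linarith [hτ.2]⟩
  obtain ⟨L, hL⟩ := levelSetModeration_slice_fderiv_bound hν hcl hLH hdec hT₁
  have hdiff : Differentiable ℝ (u τ) := (hcl.contDiff_velocity hτ).differentiable (by simp)
  refine levelSetModeration_tendsto_cocompact_of_fderiv_le hdiff (hL τ hτ₁) ?_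
  have hE := hLH.lintegral_enorm_sq_le hν.le ⟨hτ.1, hτ.2.le⟩
  exact lt_of_le_of_lt hE ENNReal.ofReal_lt_top

/-- **Super-level sets of the speed are bounded.** Under the same hypotheses, for every
`τ ∈ [0, T)` and every level `c > 0` the set `{x | c < ‖u(τ, x)‖}` is bounded — the hypothesis
`Bornology.IsBounded {x | c < ‖u τ x‖}` of the route's `ModerationIdentity` and of the level-set
integration by parts is met by every slice of a classical Leray–Hopf solution from a rapidly
decaying datum. [cite: Tao2011, Cor. 11.1] -/
theorem levelSetModeration_isBounded_superlevel :
    ∀ (ν T : ℝ) (u : ℝ → EuclideanSpace ℝ (Fin 3) → EuclideanSpace ℝ (Fin 3)) (p : ℝ → EuclideanSpace ℝ (Fin 3) → ℝ), 0 < ν → Literature.Analysis.FluidPDE.IsClassicalNSSolutionOn (Set.Ico 0 T) ν 0 u p → Literature.Analysis.FluidPDE.IsLerayHopfOn T ν 0 (u 0) u → Literature.Analysis.FluidPDE.HasRapidSpatialDecay (u 0) → ∀ τ ∈ Set.Ico 0 T, ∀ (c : ℝ), 0 < c → Bornology.IsBounded {x | c < ‖u τ x‖} :=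
  fun _ _ _ _ hν hcl hLH hdec _ hτ _ hc =>
    levelSetModeration_isBounded_superlevel_of_tendsto
      (levelSetModeration_slice_tendsto_cocompact hν hcl hLH hdec hτ) hc

end Summit.NavierStokesRegularity.NavierStokesRegularity.Theorems
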